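import Literature.IUT.HodgeTheaters.PiAvatarNFCuspLabelsAut
import HarnessLib

/-!
# `N(Π_{C̲_K}) = Stab_{N(Π_{X̲_K})}(ε⁰)`: automorphisms of `𝒟^{⊚±}` fixing the zero cusp descend to `𝒟^⊚`, and every automorphism
# of `𝒟^{⊚±}` does so after a deck translation — the NF-side half of the BOOKED surjectivity `Aut(𝒟^⊚) ↠ 𝔽_l^⋇`
# ([IUTchI] Ex 4.3 (i), Def 6.1 (v); proof-only, post-freeze additive D13, not a cone member)

S. Mochizuki, *Inter-universal Teichmüller theory I*, kurims manuscript (May 2020), Ex 4.3 (i) pp. 98–99 («`Aut_ε̲(C̲_K) ⊆ Aut(C̲_K) ≅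
Aut(𝒟^⊚)`»; the Borel subgroup `{(∗ ∗; 0 ∗)}` and its «semi-unipotent» part; «`Aut(C̲_K)/Aut_ε̲(C̲_K) ⥲ 𝔽_l^⋇`»), Def 6.1 (v) p. 158
(«`Aut_K(X̲_K) ⥲ … ⥲ 𝔽_l^{⋊±}`», «`Aut(𝒟^{⊚±}) ↠ 𝔽_l^⋇`») ([IUTchI] Ex 4.3 (i) p.99) [claim: Mochizuki2012, status: disputed] (D-0012 claim
key, series status DISPUTED — kernel theorems over abc-iut-L5-t2's REAL `InitialThetaData`, abc-iut-L5-t1's `CuspGalois`, binder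
`hS : D.CuspClassesNormaliserStable`; nothing of the series is asserted, no side is taken on [IUTchIII] Cor. 3.12).

WHAT IS PROVED (abc-iut-L5-t3, NF-side kit; L5-lead RULINGS #46 (1): the surjectivity of `toFlStarNF` stays BOOKED — this file is the
half of the booked reduction that does NOT depend on abc-iut-L5-t8's torsion monodromy or on «slope = conjExponent» (t4 step 3)):
* `mem_PiCbar_of_act_ε0` — inside `Π_C`, the elements fixing the zero cusp `ε⁰` of `X̲` are exactly `Π_C̲` (`Gal(X̲/C) = 𝔽_l ⋊ {±1}`
  acts faithfully on the cusps `≅ 𝔽_l`; the stabiliser of `0` is `{±1} = Gal(X̲/C̲)`);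
* **`mem_normalizer_PiCund_iff_actF_ε0`** — for `n ∈ N(Π_{X̲_K})`: `n ∈ N(Π_{C̲_K}) ⟺ actF n ε⁰ = ε⁰`, i.e. `Aut(𝒟^⊚)` (lifted to
  `𝒟^{⊚±}`) = the automorphisms of `𝒟^{⊚±}` FIXING THE ZERO CUSP (converse of `actF_nf_ε0`): print's Borel picture — `Aut(X̲_K)`-side
  affine `z ↦ uz + b`, `Aut(C̲_K)`-side linear `z ↦ uz`;
* **`exists_mul_embK_mem_normalizer_PiCund`** — every `m ∈ N(Π_{X̲_K})` becomes an element of `N(Π_{C̲_K})` after right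
  multiplication by a deck translation `embK g`, `g ∈ Π_X` (no `2`-divisibility needed: translate the fixed point back to `ε⁰`), with
  the SAME slope;
* **`toFlStarNF_surjective_of_slope_surjective`** — if the slope character `n ↦ [actFSlope n] ∈ 𝔽_l^⋇` is surjective on `N(Π_{X̲_K})`
  (⟸ `toFlStar_surjective` at `𝒟^{⊚±}` + t4 step 3), then `toFlStarNF : Aut(𝒟^⊚) → 𝔽_l^⋇` is surjective (⟹ NFKit law
  `exists_aut_smul`, `PiAvatarNFKitSlots.exists_aut_smul_iff_surjective`).
Proof-only; no instance/notation; typed ≠ proved elsewhere.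
-/

noncomputable section

namespace Literature.IUT.HodgeTheaters

open CategoryTheory

universe u v w

section NFCuspLabelsLift

variable {F : Type u} {K : Type v} {Fbar : Type w} [Field F] [NumberField F] [Field K] [NumberField K]
  [Algebra F K] [Field Fbar] [Algebra F Fbar] [Algebra K Fbar]
  {E : WeierstrassCurve F} [E.IsElliptic] {l : ℕ} {Pb : BadPlacePredicates K}
  (D : InitialThetaData F K Fbar E l Pb) (CG : D.geom.pe.CuspGalois) (hS : D.CuspClassesNormaliserStable)

namespace InitialThetaData

/-! ### Inside `Π_C`: the stabiliser of the zero cusp is `Π_C̲` -/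

/-- **An element of `Π_C` fixing the zero cusp `ε⁰` of `X̲` lies in `Π_C̲`** (the converse of t1's `act_ε0`): inside
`Gal(X̲/C) = Π_C/Π_X̲ ≅ 𝔽_l ⋊ {±1}` acting on the cusps, the stabiliser of `ε⁰` is `Gal(X̲/C̲) = {1, ι̲}` — if `c ∈ Π_X` it acts freely
(t1 `free`), else `c·ι̲ ∈ Π_X` (index `2`) fixes `ε⁰`, so lies in `Π_X̲`. ([IUTchI] §1 p.37) [claim: Mochizuki2012, status: disputed] -/
theorem mem_PiCbar_of_act_ε0 {c : D.geom.pe.PiC} (h : CG.act c D.geom.pe.ε0 = D.geom.pe.ε0) : c ∈ D.geom.pe.PiCbar := by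
  by_cases hcX : c ∈ D.geom.pe.PiX
  · exact (Subgroup.mem_inf.mp (CG.free c hcX _ h)).2
  · obtain ⟨i, hi, hiX⟩ := SetLike.not_le_iff_exists.mp D.pe_not_PiCbar_le_PiX
    -- `c * i ∈ Π_X` (index two) and it fixes `ε⁰`, hence lies in `Π_X̲ ≤ Π_C̲`
    have hci : c * i ∈ D.geom.pe.PiX := (Subgroup.mul_mem_iff_of_index_two D.geom.pe.index_piX).mpr (iff_of_false hcX hiX)
    have hfix : CG.act (c * i) D.geom.pe.ε0 = D.geom.pe.ε0 := by rw [map_mul, Equiv.Perm.mul_apply, CG.act_ε0 i hi, h]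
    have hbar : c * i ∈ D.geom.pe.PiXbar := CG.free _ hci _ hfix
    have hc : c = (c * i) * i⁻¹ := by rw [mul_inv_cancel_right]
    rw [hc]
    exact D.geom.pe.PiCbar.mul_mem (Subgroup.mem_inf.mp hbar).2 (D.geom.pe.PiCbar.inv_mem hi)

/-- Conversely `Π_C̲` fixes `ε⁰` (t1's `act_ε0`), so: `c ∈ Π_C̲ ⟺ c·ε⁰ = ε⁰`. ([IUTchI] §1 p.37) [claim: Mochizuki2012, status: disputed] -/
theorem mem_PiCbar_iff_act_ε0 (c : D.geom.pe.PiC) : c ∈ D.geom.pe.PiCbar ↔ CG.act c D.geom.pe.ε0 = D.geom.pe.ε0 :=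
  ⟨fun hc => CG.act_ε0 c hc, D.mem_PiCbar_of_act_ε0 CG⟩

/-! ### `N(Π_{C̲_K})` = the elements of `N(Π_{X̲_K})` fixing `ε⁰` -/

/-- One direction of normalising: if `actF n ε⁰ = ε⁰` then `n·Π_{C̲_K}·n⁻¹ ⊆ Π_{C̲_K}` (conjugates of elements of `Π_{C̲_K} = embK(Π_C̲)` lie
in `Π_{C_K} = embK(Π_C)` — t4's `exists_embK_eq_conj` — and fix `ε⁰`). ([IUTchI] Ex 4.3 (i) p.99) [claim: Mochizuki2012, status: disputed] -/
theorem conj_mem_PiCund_of_actF_ε0 (n : ↥(Subgroup.normalizer ((D.PiXund : Subgroup D.PiC) : Set D.PiC)))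
    (h : D.actF CG hS n D.geom.pe.ε0 = D.geom.pe.ε0) {x : D.PiC} (hx : x ∈ D.PiCund) :
    (n : D.PiC) * x * (n : D.PiC)⁻¹ ∈ D.PiCund := by
  obtain ⟨c, hc, rfl⟩ := Subgroup.mem_map.mp hx
  obtain ⟨c', hc'⟩ := D.exists_embK_eq_conj n c
  rw [← hc']
  refine Subgroup.mem_map_of_mem _ (D.mem_PiCbar_of_act_ε0 CG ?_)
  -- `actF (embK c′) = actF n ∘ actF (embK c) ∘ actF n⁻¹` fixes `ε⁰`
  have hnc : D.geom.embK c ∈ Subgroup.normalizer ((D.PiXund : Subgroup D.PiC) : Set D.PiC) := D.embK_mem_normalizer_PiXund CG c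
  have hnc' : D.geom.embK c' ∈ Subgroup.normalizer ((D.PiXund : Subgroup D.PiC) : Set D.PiC) := D.embK_mem_normalizer_PiXund CG c'
  have hprod : (⟨D.geom.embK c', hnc'⟩ : ↥(Subgroup.normalizer ((D.PiXund : Subgroup D.PiC) : Set D.PiC))) =
      n * ⟨D.geom.embK c, hnc⟩ * n⁻¹ := Subtype.ext hc'
  have hinv : D.actF CG hS n⁻¹ D.geom.pe.ε0 = D.geom.pe.ε0 := by
    rw [map_inv, Equiv.Perm.inv_eq_iff_eq, h]
  rw [← D.actF_embK CG hS c' hnc', hprod, map_mul, map_mul, Equiv.Perm.mul_apply, Equiv.Perm.mul_apply, hinv,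
    D.actF_embK CG hS c hnc, CG.act_ε0 c hc, h]

/-- **`N(Π_{C̲_K}) = {n ∈ N(Π_{X̲_K}) | n·ε⁰ = ε⁰}`**: an automorphism of `𝒟^{⊚±}` descends to (i.e. normalises `Π_{C̲_K}`, inducing an
automorphism of) `𝒟^⊚` iff it fixes the zero cusp (⟹ `actF_nf_ε0`; ⟸ `conj_mem_PiCund_of_actF_ε0` for `n` and `n⁻¹`).  Print: in the
Borel group `{(∗ ∗; 0 ∗)}` the image of `Aut(C̲_K)` is the diagonal part (Ex 4.3 (i)). ([IUTchI] Ex 4.3 (i) p.99) [claim: Mochizuki2012, status: disputed] -/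
theorem mem_normalizer_PiCund_iff_actF_ε0 [Fact l.Prime] (n : ↥(Subgroup.normalizer ((D.PiXund : Subgroup D.PiC) : Set D.PiC))) :
    (n : D.PiC) ∈ Subgroup.normalizer ((D.PiCund : Subgroup D.PiC) : Set D.PiC) ↔ D.actF CG hS n D.geom.pe.ε0 = D.geom.pe.ε0 := by
  constructor
  · intro hn
    exact D.actF_nf_ε0 CG hS ⟨n, hn⟩
  · intro h
    have hinv : D.actF CG hS n⁻¹ D.geom.pe.ε0 = D.geom.pe.ε0 := by rw [map_inv, Equiv.Perm.inv_eq_iff_eq, h]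
    rw [Subgroup.mem_normalizer_iff]
    intro x
    constructor
    · exact D.conj_mem_PiCund_of_actF_ε0 CG hS n h
    · intro hx
      have h2 := D.conj_mem_PiCund_of_actF_ε0 CG hS n⁻¹ hinv hx
      simpa [mul_assoc] using h2

/-! ### The lift: translate the fixed point back to `ε⁰` -/

variable [Fact l.Prime]

/-- **Every automorphism of `𝒟^{⊚±}` descends to `𝒟^⊚` after a deck translation**: for `m ∈ N(Π_{X̲_K})` there is `g ∈ Π_X` (an
element of `Gal(X̲_K/X_K)`'s preimage) with `m·embK g ∈ N(Π_{C̲_K})` — choose `g` carrying `ε⁰` to `m⁻¹·ε⁰` (t1 `transitive`) — and the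
SLOPE is unchanged (translations have slope `1`). ([IUTchI] Ex 4.3 (i) p.99) [claim: Mochizuki2012, status: disputed] -/
theorem exists_mul_embK_mem_normalizer_PiCund (m : ↥(Subgroup.normalizer ((D.PiXund : Subgroup D.PiC) : Set D.PiC))) :
    ∃ g : D.geom.pe.PiC, g ∈ D.geom.pe.PiX ∧
      (m : D.PiC) * D.geom.embK g ∈ Subgroup.normalizer ((D.PiCund : Subgroup D.PiC) : Set D.PiC) ∧
        D.actFSlope CG hS (m * ⟨D.geom.embK g, D.embK_mem_normalizer_PiXund CG g⟩) = D.actFSlope CG hS m := by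
  obtain ⟨g, hg, hgε⟩ := CG.transitive D.geom.pe.ε0 ((D.actF CG hS m)⁻¹ D.geom.pe.ε0)
  refine ⟨g, hg, ?_, ?_⟩
  · have hmem := (D.mem_normalizer_PiCund_iff_actF_ε0 CG hS (m * ⟨D.geom.embK g, D.embK_mem_normalizer_PiXund CG g⟩)).mpr
    apply hmem
    rw [map_mul, Equiv.Perm.mul_apply, D.actF_embK CG hS g, hgε, Equiv.Perm.inv_def, Equiv.apply_symm_apply]
  · rw [D.actFSlope_mul CG hS, D.actFSlope_embK_of_mem_PiX CG hS hg, mul_one]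

/-- **Surjectivity transfers from `𝒟^{⊚±}` to `𝒟^⊚`**: if the slope character `n ↦ [actFSlope n]` of `N(Π_{X̲_K})` onto `𝔽_l^⋇` is
surjective, then so is `toFlStarNF : Aut(𝒟^⊚) → 𝔽_l^⋇` (hence the NFKit law `exists_aut_smul`, `exists_aut_smul_iff_surjective`).  The
hypothesis is `toFlStar_surjective` at `𝒟^{⊚±}` (abc-iut-L5-t8's torsion monodromy) once «slope = conjExponent» (t4 step 3) is in tree —
BOOKED, not claimed here. ([IUTchI] Ex 4.3 (i) p.99) [claim: Mochizuki2012, status: disputed] -/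
theorem toFlStarNF_surjective_of_slope_surjective
    (h : Function.Surjective fun n : ↥(Subgroup.normalizer ((D.PiXund : Subgroup D.PiC) : Set D.PiC)) =>
      FlStar.mk l (D.actFSlopeUnit CG hS n)) :
    Function.Surjective (D.toFlStarNF CG hS) := by
  intro j
  obtain ⟨m, hm⟩ := h j⁻¹
  obtain ⟨g, hg, hmg, hslope⟩ := D.exists_mul_embK_mem_normalizer_PiCund CG hS m
  refine ⟨OrbitCat.autOfNormalizer ((m : D.PiC) * D.geom.embK g) hmg, ?_⟩
  rw [D.toFlStarNF_autOfNormalizer CG hS, inv_eq_iff_eq_inv]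
  have hm' : FlStar.mk l (D.actFSlopeUnit CG hS m) = j⁻¹ := hm
  rw [← hm']
  congr 1
  apply Units.ext
  rw [val_actFSlopeUnit, val_actFSlopeUnit, ← hslope]
  rfl

end InitialThetaData

end NFCuspLabelsLift

end Literature.IUT.HodgeTheaters
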